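import Literature.NumberTheory.GaloisRepresentations.DualityLineOne
import HarnessLib

/-!
# The `(1, 1)` input of the local duality dévissage over `Gal(F̄/E)` (local field)

For a non-archimedean local field `F` of characteristic `0`, a finite `E ⊆ F̄` with group
`S = Gal(F̄/E) ≤ Γ_F` (`galFixing F E`), `p ∣ n` prime and an injective `ι : H²(S, μ_n) → ℤ/n`:

* `exists_cyclicClass_ne_zero` — **every cyclic layer `χ : S → ℤ/p` has a unit `β ∈ Eˣ` with
  `κ_χ(β) ≠ 0` in `Br(E)`**: with `E_χ` the fixed field of `ker χ` (degree `p` over `E`, Galois),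
  `Br(E_χ/E)` is cyclic of order `p` (`exists_resKer_eq_zmultiples`), its generator is a cyclic class
  `κ_{χ'}(β)` for the character `χ'` of the frame deduced from `χ` (`exists_cyclicClass_eq_of_res_eq_zero`,
  Hilbert 90), and restriction along `Gal(F̄/E) = layerN L₁ D` identifies `κ_χ(β)` with it
  (`map_cyclicClass_eq_cyclicClass_derived`);
* `dualityPairing_injective_line` — **hypothesis `(1, 1)`**: for every `W` of order `p` with trivial
  `S`-action, `a ↦ ι(a ∪ ·) : H¹(S, W) → Hom(H¹(S, Hom(W, μ_n)), ℤ/n)` is injective: a nonzero `a` is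
  `[σ ↦ χ̃(σ) w₀]`, and for the Kummer line class `b` of a `p`-th root of the above `β`,
  `Kummer(a ∪ b) = κ_χ(β) ≠ 0` (`kummerTwo_cupProduct_eq_cyclicClass`).

## References
* J.-P. Serre, *Galois Cohomology*, Springer, 1997, II §5.2 Thm. 2 (proof: the case `A = ℤ/p`). [SerreGaloisCohomology1997]
* J.-P. Serre, *Corps locaux*, Hermann, 1968, XIV §1–2, XIII §3. [SerreLocalFields1979]
-/

noncomputable section

open CategoryTheory Function
open Field IsNonarchimedeanLocalField ValuativeRel IntermediateField

universe u

namespace Literature.NumberTheory.GaloisRepresentations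

open _root_.TopRep _root_.ContRepresentation _root_.ContinuousCohomology DiscreteGaloisModule
open _root_.Topology _root_.Filter
open LocalWeilDatum

section Local

variable (F : Type u) [Field F] [ValuativeRel F] [TopologicalSpace F] [IsNonarchimedeanLocalField F]
  [CharZero F]
variable (E : IntermediateField F (AlgebraicClosure F)) [FiniteDimensional F E]

attribute [local instance] compactSpace_of_isClosed_subgroup isClosed_layerN isClosed_galFixing'

/-- **Every cyclic layer `χ : Gal(F̄/E) → ℤ/p` has an `E`-unit `β` with `κ_χ(β) ≠ 0` in `Br(E)`**:
see the module docstring. [cite: SerreLocalFields1979, XIII §3 Prop. 7, XIV §1] -/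
theorem exists_cyclicClass_ne_zero {p : ℕ} [hp : Fact p.Prime] (χ : CyclicCharacter (galFixing F E) p) :
    ∃ β : ((units F).restrict (subgroupIncl (galFixing F E))).toTopRep.ρ.invariants,
      cyclicClass χ ((units F).restrict (subgroupIncl (galFixing F E))) β ≠ 0 := by
  classical
  haveI : NeZero p := ⟨hp.out.ne_zero⟩
  -- the fixed field `E_χ` of `ker χ`
  let H : Subgroup (absoluteGaloisGroup F) := χ.ker.map (galFixing F E).subtype
  have hHS : H ≤ galFixing F E := Subgroup.map_subtype_le _
  have hHopen : IsOpen (H : Set (absoluteGaloisGroup F)) := by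
    have h1 : IsOpen ((Subtype.val : galFixing F E → absoluteGaloisGroup F) '' (χ.ker : Set (galFixing F E))) :=
      (isOpen_galFixing F E).isOpenEmbedding_subtypeVal.isOpenMap _ χ.isOpen_ker
    convert h1 using 1
    ext x
    simp only [H, Subgroup.coe_map, Subgroup.coe_subtype, Set.mem_image, SetLike.mem_coe]
  -- a finite Galois `L₀` with `Gal(F̄/L₀) ≤ ker χ`
  obtain ⟨L₀, hfin, hgal, hL₀⟩ := exists_finiteDimensional_isGalois_galFixing_subset (k := F)
    (hHopen.mem_nhds H.one_mem)
  haveI := hfin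
  haveI := hgal
  have hL₀H : galFixing F L₀ ≤ H := hL₀
  have hL₀S : galFixing F L₀ ≤ galFixing F E := hL₀H.trans hHS
  have hEL₀ : E ≤ L₀ := le_of_galFixing_le F hL₀S
  -- the frame `L₁ = L₀ F_m`, `m = p f_E`
  obtain ⟨m, hmdef⟩ : ∃ m : ℕ, m = p * fDeg F E := ⟨_, rfl⟩
  have hm : 0 < m := hmdef ▸ Nat.mul_pos hp.out.pos (fDeg_pos F E)
  haveI := (unramifiedLevel_finite_abelian_unramified F hm).1
  haveI := (unramifiedLevel_finite_abelian_unramified F hm).2.1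
  let L₁ : IntermediateField F (AlgebraicClosure F) := L₀ ⊔ unramifiedLevel F m
  haveI : FiniteDimensional F L₁ := IntermediateField.finiteDimensional_sup L₀ _
  haveI : IsGalois F L₁ := isGalois_iff.2 ⟨inferInstance, inferInstance⟩
  have hEL₁ : E ≤ L₁ := hEL₀.trans le_sup_left
  have hmL : unramifiedLevel F m ≤ L₁ := le_sup_right
  have hL₁L₀ : galFixing F L₁ ≤ galFixing F L₀ := galFixing_antitone F le_sup_left
  let D : Subgroup (L₁ ≃ₐ[F] L₁) := (galFixing F E).map (resGal L₁)
  let D_L : Subgroup (L₁ ≃ₐ[F] L₁) := H.map (resGal L₁)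
  have hDE : layerN L₁ D = galFixing F E := by
    change ((galFixing F E).map (resGal L₁)).comap (resGal L₁) = galFixing F E
    rw [Subgroup.comap_map_eq_self]
    rw [ker_resGal]
    exact galFixing_antitone F hEL₁
  have hDL' : layerN L₁ D_L = H := by
    change (H.map (resGal L₁)).comap (resGal L₁) = H
    rw [Subgroup.comap_map_eq_self]
    rw [ker_resGal]
    exact hL₁L₀.trans hL₀H
  have hDL : D_L ≤ D := Subgroup.map_mono hHS
  have hHsub : H.subgroupOf (galFixing F E) = χ.ker :=
    Subgroup.comap_map_eq_self_of_injective (galFixing F E).subtype_injective χ.ker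
  have hn : (D_L.subgroupOf D).Normal :=
    normal_subgroupOf_map (resGal L₁) hHS (by rw [hHsub]; infer_instance)
  have hfield : fieldOf F L₁ D = E := by
    apply eq_of_galFixing_eq F
    rw [← layerN_eq_galFixing, hDE]
  have hrel : D_L.relIndex D = p := by
    have h1 : D_L.relIndex D = H.relIndex (galFixing F E) := by
      rw [← hDE, ← hDL']
      change _ = (D_L.comap (resGal L₁)).relIndex (D.comap (resGal L₁))
      rw [Subgroup.relIndex_comap, Subgroup.map_comap_eq_self_of_surjective (resGal_surjective L₁)]
    rw [h1, Subgroup.relIndex, hHsub, χ.index_ker]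
  have hmK : m = D_L.relIndex D * fDeg F (fieldOf F L₁ D) := by rw [hrel, hfield, hmdef]
  -- `Br(E_χ/E)` is cyclic of order `p`
  obtain ⟨u', hker, hord, -⟩ := exists_resKer_eq_zmultiples F hDL hn hm hmL hmK
  have hu'0 : u' ≠ 0 := fun h => by
    rw [h, addOrderOf_zero, hrel] at hord
    exact hp.out.one_lt.ne hord
  have hu'mem : u' ∈ resKer (units F) (layerN'_le L₁ hDL) := by
    rw [hker]
    exact AddSubgroup.mem_zmultiples u'
  -- the character of the frame deduced from `χ`
  let θ := χ.derived (inclHom hDE.le)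
  have hθ : θ.ker = layerS L₁ D D_L := by
    rw [CyclicCharacter.ker_derived]
    ext t
    rw [Subgroup.mem_comap, Subgroup.mem_subgroupOf]
    change (⟨(t : absoluteGaloisGroup F), hDE.le t.2⟩ : galFixing F E) ∈ χ.ker ↔
      (t : absoluteGaloisGroup F) ∈ layerN' L₁ D_L
    rw [show layerN' L₁ D_L = H from hDL', ← hHsub, Subgroup.mem_subgroupOf]
  haveI := normal_layerN'_subgroupOf L₁ hDL hn
  have he : χ.compOrder (inclHom hDE.le) = p := by
    rw [CyclicCharacter.compOrder_eq_index, ← CyclicCharacter.ker_derived]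
    change θ.ker.index = p
    rw [hθ, index_layerN'_subgroupOf, hrel]
  haveI : Fact (1 < χ.compOrder (inclHom hDE.le)) := ⟨by rw [he]; exact hp.out.one_lt⟩
  -- Hilbert 90 for `ker θ`
  haveI : FiniteDimensional F (lift (fixedField D_L)) :=
    (liftAlgEquiv (fixedField D_L)).toLinearEquiv.finiteDimensional
  have h1 : Subsingleton (continuousCohomology 1
      ((layerRep L₁ D).restrict (subgroupIncl (layerS L₁ D D_L))).toTopRep) :=
    (subsingleton_iff_of_continuousMulEquiv (layerSEquiv L₁ hDL)
      ((units F).restrict (subgroupIncl (galFixing F (lift (fixedField D_L)))))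
      ((layerRep L₁ D).restrict (subgroupIncl (layerS L₁ D D_L))) (fun _ _ => rfl) 1).1
      (subsingleton_one_units_galFixing (lift (fixedField D_L)))
  have hT : Subsingleton (continuousCohomology 1 (((layerRep L₁ D).restrict (subgroupIncl θ.ker))).toTopRep) := by
    rw [hθ]
    exact h1
  -- `u' = κ_θ(a₀)`
  have hres : resH θ.ker (layerRep L₁ D) 2 u' = 0 := by
    have hmap : θ.ker.map (layerN L₁ D).subtype = layerN' L₁ D_L := by
      rw [hθ]
      exact Subgroup.map_subgroupOf_eq_of_le (layerN'_le L₁ hDL)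
    rw [← resSub_eq_zero_iff_resH_eq_zero (units F) θ.ker 2 u',
      resSub_eq_zero_congr (units F) hmap (map_subtype_le' _) (layerN'_le L₁ hDL)]
    exact (mem_resKer _ _ _).1 hu'mem
  obtain ⟨a₀, ha₀⟩ := exists_cyclicClass_eq_of_res_eq_zero θ (layerRep L₁ D) hT u' hres
  -- transport to `Gal(F̄/E)`
  let β : ((units F).restrict (subgroupIncl (galFixing F E))).toTopRep.ρ.invariants :=
    ⟨(a₀ : UnitsCarrier F), fun g => a₀.2 ⟨g.1, hDE.ge g.2⟩⟩
  refine ⟨β, fun h0 => hu'0 ?_⟩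
  have hmapc := map_cyclicClass_eq_cyclicClass_derived χ (inclHom hDE.le)
    ((units F).restrict (subgroupIncl (galFixing F E))) (layerRep L₁ D) (resSubMod (units F) hDE.le)
    (fun _ => rfl) β a₀ rfl
  rw [← ha₀]
  change cyclicClass (χ.derived (inclHom hDE.le)) (layerRep L₁ D) a₀ = 0
  rw [← hmapc, h0, map_zero]

/-- **Hypothesis `(1, 1)` of the local duality dévissage over `Gal(F̄/E)`**: for `p ∣ n` prime, an
injective `ι : H²(Gal(F̄/E), μ_n) → ℤ/n` and `W` of order `p` with trivial action,
`a ↦ ι(a ∪ ·) : H¹(Gal(F̄/E), W) → Hom(H¹(Gal(F̄/E), Hom(W, μ_n)), ℤ/n)` is injective.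
[cite: SerreGaloisCohomology1997, II §5.2 Thm. 2 (proof)] -/
theorem dualityPairing_injective_line {p n : ℕ} [hp : Fact p.Prime] [NeZero n] (hpn : p ∣ n)
    (ι : continuousCohomology 2 ((mu F n).restrict (subgroupIncl (galFixing F E))).toTopRep →+ ZMod n)
    (hι : Injective ι) {W : Type u} [AddCommGroup W] [TopologicalSpace W] [DiscreteTopology W] [Finite W]
    (τ : ContinuousRep (galFixing F E) ℤ W) (hτ : ∀ (g : galFixing F E) (w : W), τ g w = w)
    (hW : Nat.card W = p) :
    Injective (τ.dualityPairing ((mu F n).restrict (subgroupIncl (galFixing F E))) ι) := by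
  refine (injective_iff_map_eq_zero _).2 fun a ha => by_contra fun ha0 => ?_
  obtain ⟨χ, w₀, hw₀, rfl⟩ := τ.exists_eq_oneCocycleClass_homCocycle hτ hW a ha0
  obtain ⟨β, hβ0⟩ := exists_cyclicClass_ne_zero F E χ
  obtain ⟨r, hr⟩ := (isSES_kummer F p hp.out.pos).surjective (β : UnitsCarrier F)
  have hr' : (p : ℤ) • r = (β : UnitsCarrier F) := hr
  have hβ : ∀ s : galFixing F E, units F (s : absoluteGaloisGroup F) (β : UnitsCarrier F) = β := β.2
  let b := kummerLineCocycle F (galFixing F E) hpn r (β : UnitsCarrier F) hr' hβ τ hτ hW hw₀ (NeZero.pos n)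
  have hcup := kummerTwo_cupProduct_eq_cyclicClass F (galFixing F E) hpn r (β : UnitsCarrier F) hr' hβ
    τ hτ hW hw₀ (NeZero.pos n) χ
  have h1 : τ.dualityPairing ((mu F n).restrict (subgroupIncl (galFixing F E))) ι
      (oneCocycleClass τ.toTopRep (τ.homCocycle hτ hW χ w₀)) (oneCocycleClass _ b) = 0 := by
    rw [ha, AddMonoidHom.zero_apply]
  rw [ContinuousRep.dualityPairing_apply] at h1
  have h2 := hι (h1.trans (map_zero ι).symm)
  apply hβ0
  have hβeq : (⟨(β : UnitsCarrier F), fun s => hβ s⟩ :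
      ((units F).restrict (subgroupIncl (galFixing F E))).toTopRep.ρ.invariants) = β := Subtype.ext rfl
  rw [← hβeq, ← hcup, h2, map_zero]

end Local

end Literature.NumberTheory.GaloisRepresentations

end
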